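import Literature.AlgebraicGeometry.Morphisms.CechUnitCocycleModelData
import Literature.AlgebraicGeometry.Morphisms.CechUnitCocycleResidueFaceClass
import HarnessLib

/-!
# Model data for a NON-constant family: `Γ(U_a) ⊗_A R ≅ Γ(X ×_A Spec R, g⁻¹U_a)` on an affine cover, its change of level
# and its restriction to a face (the dictionary «line bundles on `X_R` ↔ unit cocycles with coefficients in `R`»)

Layer `Literature/AlgebraicGeometry/Morphisms`, namespace `Literature.AlgebraicGeometry.Morphisms.CechUnitCocycle`.
THEOREMS ONLY (no definition, no named fact, no instance, no notation).  Cell `hodgecm-mathlib` (D-0151), F-2d road (R-def)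
«theorem of the cube over a NON-reduced base by Artinian induction», brick Č4b (author B-p07 (g16)).

★ `Morphisms/CechUnitCocycleModelData` (M13 N3) is the GENERIC dictionary between line bundles on a scheme `Y` «= X × Spec R»
framed on a cover `W` «= pr⁻¹𝒰» and unit cocycles with coefficients (★ `UCocycle f U R`): `ModelData f U R Y W` (ring
isomorphisms `Γ(U_a) ⊗_A R ≅ Γ(Y, W_a)` on single/double/triple overlaps compatible with restriction), the MODEL COCYCLE
`Φ.cocycle F` of an indexed frame system `F`, ISO ⟹ REL (`rel_cocycle_of_iso`), REL ⟹ ISO (`nonempty_iso_of_rel`), and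
`ModelData.Hom.cocycle_pullback` (change of level); its only ★ instance `absModelData` is the CONSTANT family `P ×_K Spec R`
over a field.  This file supplies the instance for an ARBITRARY cartesian square `Z = X ×_A Spec R` (★ `IsPullback g fZ f
(Spec (A → R))`, any commutative `A`, any `A`-algebra `R`) on a cover `𝒰` of `X` by affine opens with affine double and triple
intersections, through the affine base change of sections ★ `bcSections_bijective_of_isAffineOpen` ([GortzWedhorn2020] Prop.
4.20 / [StacksProject] Tag 02KG) — in the ∃-form with characterising equations (theorems only): the model isomorphisms ARE
the maps `(bcSections f fZ g _ _).comp (TensorProduct.comm …)` of ★ Č2 `CechUnitCocycleResidueFibreClass` §1.  With ★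
Č4c/Č4c′ (`CechUnitCocycleTwoFaceLift/Tower`) this is what lets a line bundle on a flat family enter Step (I) of
[GortzWedhorn2023] Lemma 24.72 as a compatible tower of unit cocycles and come back as «trivial on every `X ⊗ 𝒪_{T,t}/𝔪^{n+1}`».

* §1 **`exists_modelData_of_isPullback`** — the model data of `Z = X ×_A Spec R` on `g⁻¹𝒰`, with `Φ₁`, `Φ₂`, `Φ₃` given by
  ★ `bcSections`;
* §2 `toSectionsBase_eq_appLE`, `comap_toSectionsBase`, `comp_restrictBase_of_comp_eq_comp_Spec`, **`comap_bcSections_comm_coef`**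
  — naturality of the model maps under a change of level `ψ : R → R'` covered by `τ : Z' → Z`;
* §3 **`modelData_hom_of_isPullback`** — such model data are related by a ★ `ModelData.Hom` along `(ψ, τ)` (so pulled-back frames
  have model cocycle `u.map ψ`, ★ `ModelData.Hom.cocycle_pullback`);
* §4 `bcSections_comm_congr`, **`cocycle_val_eq_map_comap_of_face`** — RESTRICTION TO A FACE `jY : Y → X`: for model data of `X_R`
  and of `Y_R` and frames `F`, `G` with `G.tf = jY_R^* F.tf`, the model cocycle of `G` is `map (comap jY) id` of that of `F`
  (the shape of the face hypotheses `huY_m` of ★ Č4c `exists_rel_of_rel_map_of_rel_faces`).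

HC_CM is proved only modulo the 7 printed citations until rung 0 closes; nothing here is about HC.

## References
* [GortzWedhorn2020] U. Görtz, T. Wedhorn, *Algebraic Geometry I*, 2nd ed. (2020), Prop. 4.20 (affine base change of sections),
  Prop. 11.15 and Remark 11.16 (line bundles by cocycles).
* [StacksProject] The Stacks Project, Tag 02KG (Cohomology of Schemes, Lemma 30.5.1), Tag 02KE, Tag 01ED.
* [Hartshorne1977] R. Hartshorne, *Algebraic Geometry*, III Ex. 4.5.
* [GortzWedhorn2023] U. Görtz, T. Wedhorn, *Algebraic Geometry II* (2023), Lemma 24.72 proof Step (I) (p. 409).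
-/

noncomputable section

universe u v

open TensorProduct CategoryTheory AlgebraicGeometry
open Literature.AlgebraicGeometry.Modules

namespace Literature.AlgebraicGeometry.Morphisms

namespace CechUnitCocycle

variable {A : Type u} [CommRing A] {X : Scheme.{u}} {f : X ⟶ Spec (.of A)} {ι : Type v} {U : ι → X.Opens}
variable {R : Type u} [CommRing R] [Algebra A R] {Z : Scheme.{u}} {fZ : Z ⟶ Spec (.of R)} {g : Z ⟶ X}

/-- `g⁻¹U_a ∩ g⁻¹U_b ⊆ g⁻¹(U_a ∩ U_b)` (private plumbing). [folklore] -/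
private theorem pre2 {Y : Scheme.{u}} (g : Y ⟶ X) (U : ι → X.Opens) (a b : ι) :
    preimageFamily g U a ⊓ preimageFamily g U b ≤ g ⁻¹ᵁ (U a ⊓ U b) :=
  fun _ hx => hx

/-- `g⁻¹U_a ∩ g⁻¹U_b ∩ g⁻¹U_c ⊆ g⁻¹(U_a ∩ U_b ∩ U_c)` (private plumbing). [folklore] -/
private theorem pre3 {Y : Scheme.{u}} (g : Y ⟶ X) (U : ι → X.Opens) (a b c : ι) :
    preimageFamily g U a ⊓ preimageFamily g U b ⊓ preimageFamily g U c ≤ g ⁻¹ᵁ (U a ⊓ U b ⊓ U c) :=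
  fun _ hx => hx

/-! ## §1 The model data of `Z = X ×_A Spec R` on the preimage of an affine cover -/

/-- **MODEL DATA OF A BASE CHANGE**: for the cartesian square `Z = X ×_A Spec R` (`g : Z → X`, `fZ : Z → Spec R`, any `A → R`)
and a cover `𝒰` of `X` by affine opens with affine double and triple intersections, the affine base change of sections (★
`bcSections_bijective_of_isAffineOpen`) gives ring isomorphisms `Γ(U_a) ⊗_A R ≅ Γ(Z, g⁻¹U_a)`, `Γ(U_a ∩ U_b) ⊗_A R ≅
Γ(Z, g⁻¹U_a ∩ g⁻¹U_b)`, `Γ(U_{abc}) ⊗_A R ≅ Γ(Z, g⁻¹U_{abc})` compatible with restriction, i.e. a ★ `ModelData f U R Z (g⁻¹𝒰)`,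
whose components ARE the maps `s ⊗ r ↦ f_Z^*(r) · g^*(s)` (★ Č2's inline `(bcSections …).comp (TensorProduct.comm …)`).
[cite: GortzWedhorn2020, Prop. 4.20] [cite: StacksProject, Tag 02KG] -/
theorem exists_modelData_of_isPullback (HP : IsPullback g fZ f (Spec.map (CommRingCat.ofHom (algebraMap A R))))
    (hU : ∀ a, IsAffineOpen (U a)) (hU2 : ∀ a b, IsAffineOpen (U a ⊓ U b))
    (hU3 : ∀ a b c, IsAffineOpen (U a ⊓ U b ⊓ U c)) :
    ∃ Φ : ModelData f U R Z (preimageFamily g U),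
      (∀ a x, Φ.Φ₁ a x = (bcSections f fZ g HP.w (le_refl (g ⁻¹ᵁ U a))).comp
        (Algebra.TensorProduct.comm A (Sections f (U a)) R).toAlgHom x) ∧
      (∀ a b x, Φ.Φ₂ a b x = (bcSections f fZ g HP.w (pre2 g U a b)).comp
        (Algebra.TensorProduct.comm A (Sections f (U a ⊓ U b)) R).toAlgHom x) ∧
      (∀ a b c x, Φ.Φ₃ a b c x = (bcSections f fZ g HP.w (pre3 g U a b c)).comp
        (Algebra.TensorProduct.comm A (Sections f (U a ⊓ U b ⊓ U c)) R).toAlgHom x) := by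
  -- the three families of isomorphisms
  let Φ₁ : ∀ a, Sections f (U a) ⊗[A] R ≃+* Γ(Z, preimageFamily g U a) := fun a =>
    (AlgEquiv.ofBijective ((bcSections f fZ g HP.w (le_refl (g ⁻¹ᵁ U a))).comp
      (Algebra.TensorProduct.comm A (Sections f (U a)) R).toAlgHom) (bcSections_comm_bijective HP (hU a))).toRingEquiv
  let Φ₂ : ∀ a b, Sections f (U a ⊓ U b) ⊗[A] R ≃+* Γ(Z, preimageFamily g U a ⊓ preimageFamily g U b) := fun a b =>
    (AlgEquiv.ofBijective ((bcSections f fZ g HP.w (pre2 g U a b)).comp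
      (Algebra.TensorProduct.comm A (Sections f (U a ⊓ U b)) R).toAlgHom) (bcSections_comm_bijective HP (hU2 a b))).toRingEquiv
  let Φ₃ : ∀ a b c, Sections f (U a ⊓ U b ⊓ U c) ⊗[A] R ≃+*
      Γ(Z, preimageFamily g U a ⊓ preimageFamily g U b ⊓ preimageFamily g U c) := fun a b c =>
    (AlgEquiv.ofBijective ((bcSections f fZ g HP.w (pre3 g U a b c)).comp
      (Algebra.TensorProduct.comm A (Sections f (U a ⊓ U b ⊓ U c)) R).toAlgHom)
        (bcSections_comm_bijective HP (hU3 a b c))).toRingEquiv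
  refine ⟨⟨Φ₁, Φ₂, Φ₃, fun a b x => ?_, fun a b x => ?_, fun a b c x => ?_, fun a b c x => ?_, fun a b c x => ?_⟩,
    fun a x => rfl, fun a b x => rfl, fun a b c x => rfl⟩
  · exact (res_bcSections_comm HP.w (le_refl _) (pre2 g U a b) (inf_le_left : U a ⊓ U b ≤ U a)
      (inf_le_left : preimageFamily g U a ⊓ preimageFamily g U b ≤ preimageFamily g U a) x).symm
  · exact (res_bcSections_comm HP.w (le_refl _) (pre2 g U a b) (inf_le_right : U a ⊓ U b ≤ U b)
      (inf_le_right : preimageFamily g U a ⊓ preimageFamily g U b ≤ preimageFamily g U b) x).symm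
  · exact (res_bcSections_comm HP.w (pre2 g U a b) (pre3 g U a b c) (le12 (U := U) a b c)
      (le12 (U := preimageFamily g U) a b c) x).symm
  · exact (res_bcSections_comm HP.w (pre2 g U b c) (pre3 g U a b c) (le23 (U := U) a b c)
      (le23 (U := preimageFamily g U) a b c) x).symm
  · exact (res_bcSections_comm HP.w (pre2 g U a c) (pre3 g U a b c) (le13 (U := U) a b c)
      (le13 (U := preimageFamily g U) a b c) x).symm

/-! ## §2 Naturality of the model maps under a change of level -/

section Level

variable {R' : Type u} [CommRing R'] [Algebra A R'] {Z' : Scheme.{u}} {fZ' : Z' ⟶ Spec (.of R')} (ψ : R →ₐ[A] R')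
  (τ : Z' ⟶ Z) (hτf : τ ≫ fZ = fZ' ≫ Spec.map (CommRingCat.ofHom ψ.toRingHom))

/-- `f_Z^*(r)|_W` unfolded: ★ `toSectionsBase` is `f_Z^♯` on `Γ(Spec R, 𝒪) = R` (Mathlib `Scheme.ΓSpecIso`) followed by
restriction. [cite: StacksProject, Tag 02KE] -/
theorem toSectionsBase_eq_appLE (W : Z.Opens) (r : R) :
    toSectionsBase A fZ W r = fZ.appLE ⊤ W le_top ((Scheme.ΓSpecIso (.of R)).inv r) :=
  rfl

/-- `Spec ψ ≫ Spec (A → R) = Spec (A → R')` for an `A`-algebra map `ψ`. [cite: GortzWedhorn2020, Section (4.7) (pp. 107–108)] -/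
theorem Spec_map_algHom_comp :
    Spec.map (CommRingCat.ofHom ψ.toRingHom) ≫ Spec.map (CommRingCat.ofHom (algebraMap A R)) =
      Spec.map (CommRingCat.ofHom (algebraMap A R')) := by
  rw [← Spec.map_comp]
  congr 1
  ext r
  change ψ (algebraMap A R r) = algebraMap A R' r
  exact ψ.commutes r

include hτf in
/-- A morphism `τ : Z' → Z` covering `Spec ψ` is a morphism of `A`-schemes for the `restrictBase` structures.
[cite: GortzWedhorn2020, Section (4.7) (pp. 107–108)] -/
theorem comp_restrictBase_of_comp_eq_comp_Spec : τ ≫ restrictBase A fZ = restrictBase A fZ' := by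
  rw [restrictBase, ← Category.assoc, hτf, Category.assoc, Spec_map_algHom_comp]

include hτf in
/-- **`τ^* ∘ f_Z^* = f_{Z'}^* ∘ ψ` on functions**: pulling `f_Z^*(r)|_W` back along `τ` gives `f_{Z'}^*(ψ r)|_{W'}`.
[cite: StacksProject, Tag 02KE] -/
theorem comap_toSectionsBase {W : Z.Opens} {W' : Z'.Opens} (e' : W' ≤ τ ⁻¹ᵁ W) (r : R) :
    Sections.comap (restrictBase A fZ) (restrictBase A fZ') τ (comp_restrictBase_of_comp_eq_comp_Spec ψ τ hτf) e'
        (toSectionsBase A fZ W r) = toSectionsBase A fZ' W' (ψ r) := by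
  rw [Sections.comap_apply, toSectionsBase_eq_appLE, toSectionsBase_eq_appLE, ← CommRingCat.comp_apply,
    Scheme.Hom.appLE_comp_appLE]
  have key : ∀ {φ : Z' ⟶ Spec (CommRingCat.of R)}
      (_ : φ = fZ' ≫ Spec.map (CommRingCat.ofHom ψ.toRingHom)) (h : W' ≤ φ ⁻¹ᵁ ⊤),
      φ.appLE ⊤ W' h ((Scheme.ΓSpecIso (.of R)).inv r) =
        fZ'.appLE ⊤ W' le_top ((Scheme.ΓSpecIso (.of R')).inv (ψ r)) := by
    rintro _ rfl h
    rw [← Scheme.Hom.appLE_comp_appLE _ _ ⊤ ⊤ W' le_top le_top, CommRingCat.comp_apply]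
    congr 1
    have hnat := Scheme.ΓSpecIso_inv_naturality (CommRingCat.ofHom ψ.toRingHom)
    have happ : (Spec.map (CommRingCat.ofHom ψ.toRingHom)).appLE ⊤ ⊤ le_top =
        (Spec.map (CommRingCat.ofHom ψ.toRingHom)).appTop := rfl
    rw [happ]
    exact (CategoryTheory.congr_fun hnat r).symm
  exact key hτf _

include hτf in
/-- **Naturality of the model maps under a change of level**: for `τ : Z' → Z` covering `Spec ψ` and commuting with the maps
to `X` (`τ ≫ g = g'`), `τ^*((x)^Z|_W) = (id ⊗ ψ)(x)^{Z'}|_{W'}`. [cite: StacksProject, Tag 02KE] [cite: StacksProject, Tag 02KG] -/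
theorem comap_bcSections_comm_coef (hg : g ≫ f = restrictBase A fZ) {g' : Z' ⟶ X} (hτg : τ ≫ g = g')
    (hg' : g' ≫ f = restrictBase A fZ') {V : X.Opens} {W : Z.Opens} {W' : Z'.Opens} (e : W ≤ g ⁻¹ᵁ V) (e' : W' ≤ τ ⁻¹ᵁ W)
    (e'' : W' ≤ g' ⁻¹ᵁ V) (x : Sections f V ⊗[A] R) :
    Sections.comap (restrictBase A fZ) (restrictBase A fZ') τ (comp_restrictBase_of_comp_eq_comp_Spec ψ τ hτf) e'
        ((bcSections f fZ g hg e).comp (Algebra.TensorProduct.comm A (Sections f V) R).toAlgHom x) =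
      (bcSections f fZ' g' hg' e'').comp (Algebra.TensorProduct.comm A (Sections f V) R').toAlgHom (coef f ψ V x) := by
  subst hτg
  induction x using TensorProduct.induction_on with
  | zero => simp only [map_zero]
  | tmul s r =>
      rw [coef_tmul, bcSections_comm_tmul, bcSections_comm_tmul, map_mul, comap_toSectionsBase ψ τ hτf,
        Sections.comap_comp f (restrictBase A fZ) (restrictBase A fZ') g τ hg _ e e']
  | add x y hx hy => simp only [map_add, hx, hy]

end Level

/-! ## §3 Change of level is a morphism of model data -/

/-- **The model data of `X ×_A Spec R` and `X ×_A Spec R'` are related along `ψ : R → R'` and any `τ : Z' → Z` covering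
`Spec ψ` over `X`** (★ `ModelData.Hom`: `τ⁻¹(g⁻¹U_a) = g'⁻¹U_a` and the model isos intertwine `id ⊗ ψ` with `τ^*`); hence pulled
back frames have model cocycle `(model cocycle).map ψ` (★ `ModelData.Hom.cocycle_pullback`). [cite: StacksProject, Tag 02KG] -/
theorem modelData_hom_of_isPullback {R' : Type u} [CommRing R'] [Algebra A R'] {Z' : Scheme.{u}}
    {fZ' : Z' ⟶ Spec (.of R')} {g' : Z' ⟶ X} (hg : g ≫ f = restrictBase A fZ) (hg' : g' ≫ f = restrictBase A fZ')
    (ψ : R →ₐ[A] R') (τ : Z' ⟶ Z) (hτf : τ ≫ fZ = fZ' ≫ Spec.map (CommRingCat.ofHom ψ.toRingHom)) (hτg : τ ≫ g = g')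
    (Φ : ModelData f U R Z (preimageFamily g U))
    (hΦ : ∀ a b x, Φ.Φ₂ a b x = (bcSections f fZ g hg (pre2 g U a b)).comp
      (Algebra.TensorProduct.comm A (Sections f (U a ⊓ U b)) R).toAlgHom x)
    (Φ' : ModelData f U R' Z' (preimageFamily g' U))
    (hΦ' : ∀ a b x, Φ'.Φ₂ a b x = (bcSections f fZ' g' hg' (pre2 g' U a b)).comp
      (Algebra.TensorProduct.comm A (Sections f (U a ⊓ U b)) R').toAlgHom x) :
    Φ.Hom Φ' ψ τ := by
  have hpre : ∀ a, τ ⁻¹ᵁ preimageFamily g U a = preimageFamily g' U a := fun a => by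
    change (τ ≫ g) ⁻¹ᵁ U a = g' ⁻¹ᵁ U a
    rw [hτg]
  refine ⟨hpre, fun a b x => ?_⟩
  rw [hΦ', hΦ]
  have e' : preimageFamily g' U a ⊓ preimageFamily g' U b ≤ τ ⁻¹ᵁ (preimageFamily g U a ⊓ preimageFamily g U b) := by
    rw [← hpre, ← hpre]; exact le_rfl
  exact (comap_bcSections_comm_coef ψ τ hτf hg hτg hg' (pre2 g U a b) e' (pre2 g' U a b) x).symm

/-! ## §4 Restriction to a face -/

/-- Transport of the model map along an equality of test morphisms `φ = φ'` (private-free congr; the opens agree).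
[cite: StacksProject, Tag 02KE] -/
theorem bcSections_comm_congr {W : Scheme.{u}} {fW : W ⟶ Spec (.of R)} {φ φ' : W ⟶ X} (eφ : φ = φ')
    (hφ : φ ≫ f = restrictBase A fW) (hφ' : φ' ≫ f = restrictBase A fW) {V : X.Opens} {T : W.Opens} (e : T ≤ φ ⁻¹ᵁ V)
    (e' : T ≤ φ' ⁻¹ᵁ V) (x : Sections f V ⊗[A] R) :
    (bcSections f fW φ hφ e).comp (Algebra.TensorProduct.comm A (Sections f V) R).toAlgHom x =
      (bcSections f fW φ' hφ' e').comp (Algebra.TensorProduct.comm A (Sections f V) R).toAlgHom x := by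
  subst eφ
  rfl

/-- **RESTRICTION TO A FACE**: let `jY : Y → X` be a morphism of `A`-schemes, `Z = X ×_A Spec R` (`g`, `fZ`) and
`Z_Y = Y ×_A Spec R` (`gY`, `fZY`) with `jR : Z_Y → Z` over `Spec R` and over `jY` (`jR ≫ g = gY ≫ jY`); let `Φ`, `Φ_Y` be model
data of `Z` on `g⁻¹𝒰` and of `Z_Y` on `gY⁻¹jY⁻¹𝒰` given by ★ `bcSections` (§1).  If `G` is a frame system on `Z_Y` whose
transition functions are the pull-backs `jR^*` of those of a frame system `F` on `Z` (e.g. the pulled-back frames of `jR^*M`),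
then the model cocycle of `G` is the componentwise restriction `(comap jY) ⊗ id` of the model cocycle of `F` — the shape of the
face hypotheses of ★ Č4c `exists_rel_of_rel_map_of_rel_faces`. [cite: StacksProject, Tag 02KG]
[cite: GortzWedhorn2020, Prop. 11.15 and Remark 11.16] -/
theorem cocycle_val_eq_map_comap_of_face {Y ZY : Scheme.{u}} {fY : Y ⟶ Spec (.of A)} {jY : Y ⟶ X} (hj : jY ≫ f = fY)
    (hg : g ≫ f = restrictBase A fZ) {fZY : ZY ⟶ Spec (.of R)} {gY : ZY ⟶ Y} (hgY : gY ≫ fY = restrictBase A fZY)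
    {jR : ZY ⟶ Z} (hjR : jR ≫ fZ = fZY) (hsq : jR ≫ g = gY ≫ jY)
    (Φ : ModelData f U R Z (preimageFamily g U))
    (hΦ : ∀ a b x, Φ.Φ₂ a b x = (bcSections f fZ g hg (pre2 g U a b)).comp
      (Algebra.TensorProduct.comm A (Sections f (U a ⊓ U b)) R).toAlgHom x)
    (ΦY : ModelData fY (preimageFamily jY U) R ZY (preimageFamily gY (preimageFamily jY U)))
    (hΦY : ∀ a b x, ΦY.Φ₂ a b x = (bcSections fY fZY gY hgY (pre2 gY (preimageFamily jY U) a b)).comp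
      (Algebra.TensorProduct.comm A (Sections fY (preimageFamily jY U a ⊓ preimageFamily jY U b)) R).toAlgHom x)
    {M : Z.Modules} (F : IFrames M (preimageFamily g U)) {M' : ZY.Modules}
    (G : IFrames M' (preimageFamily gY (preimageFamily jY U)))
    (hle : ∀ a b, preimageFamily gY (preimageFamily jY U) a ⊓ preimageFamily gY (preimageFamily jY U) b ≤
      jR ⁻¹ᵁ (preimageFamily g U a ⊓ preimageFamily g U b))
    (hG : ∀ a b, G.tf a b = jR.appLE _ _ (hle a b) (F.tf a b)) (a b : ι) :
    (ΦY.cocycle G).val a b =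
      Algebra.TensorProduct.map (Sections.comap f fY jY hj (pre2 jY U a b)) (AlgHom.id A R) ((Φ.cocycle F).val a b) := by
  apply (ΦY.Φ₂ a b).injective
  rw [ModelData.cocycle_val, RingEquiv.apply_symm_apply, hG, ModelData.cocycle_val, hΦY]
  set x := (Φ.Φ₂ a b).symm (F.tf a b) with hxdef
  have hx : F.tf a b = Φ.Φ₂ a b x := ((Φ.Φ₂ a b).apply_symm_apply _).symm
  rw [hx, hΦ, bcSections_comm_comap hj hgY (pre2 jY U a b) (pre2 gY (preimageFamily jY U) a b) x]
  have step := comap_bcSections_comm hg hjR (pre2 g U a b) (hle a b) x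
  rw [Sections.comap_apply] at step
  rw [step]
  exact bcSections_comm_congr hsq _ _ _ _ _

end CechUnitCocycle

end Literature.AlgebraicGeometry.Morphisms

end
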